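import Summits.Ventures.Crystal3D.Theorems.StickyWulffConstantGenericWallFloorBarlowRowBottomFamily
import HarnessLib

/-!
# Row F4, top plate: the downward ROW walker family of the top Barlow plate's «++» c-layers delivers every input of
# `walkerFamilies_card_le_payers` (crux `GenericWallFloor`, stmt-Ventures-19480, line `WallLedgerG`; lane T's row corner, (xxxvii⁗))

HONEST FRAMING. Venture `Summits/Ventures/Crystal3D` (cell `crystal3d-full`), helper `--supports` the crux `GenericWallFloor`
(stmt-Ventures-19480) of `route-Ventures-StickyWulffConstant`, registered line `WallLedgerG`, open stub `stub_twoSlabAdhesion`.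
Rung credit only; F-C1 not moved; NOT the stub, not yet the row count.

Mirror of `rowBottomFamily_spec` (`…BarlowRowBottomFamily`) for the TOP plate `P₂ = stacking L₂ s₂ σ₂ ∩ [h+R₀, h+2R₀] × {lat ≤ ρ}`,
vertical `−e₃` (heights `⟪·, −e₃⟫` in the family hypotheses, as in `topFamily_spec`): row direction `r = α u + β v` with
`√2/2 ≤ ⟪L₂ r, −e₃⟫`; CROSSING sites of «++» c-layers (`σ₂ (mi i) = 1 = σ₂ (mi i − 1)`) at `(−e₃)`-height `≥ H` with
row-predecessors strictly below `H`, `−(h+2R₀)+2 ≤ H ≤ −(h+R₀)−3`.  Per member: validity, certificate, fuel, end ∈ `PAY`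
(NOT LOW: `walkEnd_not_low_barlow` — row reach set off the bottom stacking; NOT HIGH: sealing above + twelve neighbours), end ∈ the
row reach set of grain 2, and injectivity of `walkRun X (−e₃) N` on the family (`rowFamily_walkRun_injOn`).
* **`rowTopFamily_spec`**.
WHAT THIS IS NOT: the three corner counts are the next file; F-C1 not moved.
-/

noncomputable section

namespace Summit.Ventures.Crystal3D.Theorems

open Finset
open Literature.MathematicalPhysics.StatisticalMechanics
open Summit.Ventures.Crystal3D.Cruxes.TextureLiminf.TexShadow (stacking)
open scoped InnerProductSpace

variable {X : Finset (EuclideanSpace ℝ (Fin 3))}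

section Cell

variable (σ₂ : ℤ → ℤ) (L₂ : EuclideanSpace ℝ (Fin 3) ≃ₗᵢ[ℝ] EuclideanSpace ℝ (Fin 3)) (s₂ : EuclideanSpace ℝ (Fin 3))

open scoped Classical in
/-- **The top ROW family delivers every input of the two-family count** (vertical `−e₃`).  See the module docstring. -/
theorem rowTopFamily_spec (hσ₂ : IsHaggSeq σ₂) (hX : ∀ p ∈ X, ∀ q ∈ X, p ≠ q → 1 ≤ dist p q)
    {sE : EuclideanSpace ℝ (Fin 3)} (hsE : sE ∈ fccSlots) (hcert : ExactOnly 0 (fccSlots.filter fun w => 0 < ⟪w, sE⟫_ℝ))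
    -- the cell
    {σ₁ : ℤ → ℤ} (hσ₁ : IsHaggSeq σ₁) (L₁ : EuclideanSpace ℝ (Fin 3) ≃ₗᵢ[ℝ] EuclideanSpace ℝ (Fin 3)) (s₀ : EuclideanSpace ℝ (Fin 3))
    (R₀ h ρ : ℝ) (hR₀ : 6 ≤ R₀) (hh : 0 ≤ h) (hρ : 1 ≤ ρ) (P₁ P₂ : Finset (EuclideanSpace ℝ (Fin 3))) (hP₁X : P₁ ⊆ X) (hP₂X : P₂ ⊆ X)
    (hcell : ∀ p ∈ X, -(2 * R₀) ≤ p 2 ∧ p 2 ≤ h + 2 * R₀ ∧ p 0 ^ 2 + p 1 ^ 2 ≤ ρ ^ 2)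
    (hP₁ : ∀ p, p ∈ P₁ ↔ (p ∈ stacking L₁ s₀ σ₁ ∧ -(2 * R₀) ≤ p 2 ∧ p 2 ≤ -R₀ ∧ p 0 ^ 2 + p 1 ^ 2 ≤ ρ ^ 2))
    (hP₂ : ∀ p, p ∈ P₂ ↔ (p ∈ stacking L₂ s₂ σ₂ ∧ h + R₀ ≤ p 2 ∧ p 2 ≤ h + 2 * R₀ ∧ p 0 ^ 2 + p 1 ^ 2 ≤ ρ ^ 2))
    -- the row data
    {r : EuclideanSpace ℝ (Fin 3)} (hr : r ∈ fccSlots) (α β : ℤ)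
    (hrαβ : r = (α : ℝ) • triangularVec₁ 1 + (β : ℝ) • triangularVec₂ 1)
    (hsteep : Real.sqrt 2 / 2 ≤ ⟪L₂ r, -EuclideanSpace.single (2 : Fin 3) (1 : ℝ)⟫_ℝ)
    -- off-registry
    (hoff : ∀ y ∈ reachSet L₂ (L₂ ((haggLabel σ₂ 0 : ℝ) • barlowOffset 1) + s₂)
      (insert (twinFrame L₂ (L₂ (EuclideanSpace.single (2 : Fin 3) (1 : ℝ))))
        (chainFrames (-EuclideanSpace.single (2 : Fin 3) (1 : ℝ)) L₂ r)), y ∉ stacking L₁ s₀ σ₁)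
    -- the family (heights along −e₃)
    (H ρin : ℝ) (hHlo : -(h + 2 * R₀) + 2 ≤ H) (hHhi : H ≤ -(h + R₀) - 3)
    (hρin : ρin + 8 / 3 * (h + 4 * R₀) + 2 ≤ ρ - 1)
    {ι : Type*} (T : Finset ι) (mi ai bi : ι → ℤ)
    (hcc : ∀ i ∈ T, σ₂ (mi i) = 1 ∧ σ₂ (mi i - 1) = 1)
    (hlow : ∀ i ∈ T, H ≤ ⟪L₂ (barlowPos 1 (Real.sqrt (2 / 3)) σ₂ (mi i) (ai i) (bi i)) + s₂, -EuclideanSpace.single (2 : Fin 3) (1 : ℝ)⟫_ℝ)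
    (hpred : ∀ i ∈ T, ⟪L₂ (barlowPos 1 (Real.sqrt (2 / 3)) σ₂ (mi i) (ai i - α) (bi i - β)) + s₂,
      -EuclideanSpace.single (2 : Fin 3) (1 : ℝ)⟫_ℝ < H)
    (hinjT : ∀ i ∈ T, ∀ j ∈ T,
      barlowPos 1 (Real.sqrt (2 / 3)) σ₂ (mi i) (ai i) (bi i) = barlowPos 1 (Real.sqrt (2 / 3)) σ₂ (mi j) (ai j) (bi j) → i = j)
    (hlat : ∀ i ∈ T, Real.sqrt ((L₂ (barlowPos 1 (Real.sqrt (2 / 3)) σ₂ (mi i) (ai i) (bi i)) + s₂) 0 ^ 2 +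
      (L₂ (barlowPos 1 (Real.sqrt (2 / 3)) σ₂ (mi i) (ai i) (bi i)) + s₂) 1 ^ 2) ≤ ρin)
    -- fuel
    {N : ℕ} (hN2 : 8 * (h + 4 * R₀) < 3 * (N : ℝ)) :
    (∀ i ∈ T,
      WalkInv X (-EuclideanSpace.single (2 : Fin 3) (1 : ℝ))
          (L₂ (barlowPos 1 (Real.sqrt (2 / 3)) σ₂ (mi i) (ai i) (bi i)) + s₂, [⟨L₂, r, 0⟩]) ∧
      StackWF (-EuclideanSpace.single (2 : Fin 3) (1 : ℝ)) ([⟨L₂, r, 0⟩] : List WalkEntry) ∧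
      ([⟨L₂, r, 0⟩] : List WalkEntry).getLast? = some ⟨L₂, r, 0⟩ ∧
      (∃ e rest, ([⟨L₂, r, 0⟩] : List WalkEntry) = e :: rest ∧
        WalkCertified12 X (L₂ (barlowPos 1 (Real.sqrt (2 / 3)) σ₂ (mi i) (ai i) (bi i)) + s₂) e) ∧
      8 * (2 * R₀ - ⟪L₂ (barlowPos 1 (Real.sqrt (2 / 3)) σ₂ (mi i) (ai i) (bi i)) + s₂,
        -EuclideanSpace.single (2 : Fin 3) (1 : ℝ)⟫_ℝ) < 3 * N ∧
      (walkRun X (-EuclideanSpace.single (2 : Fin 3) (1 : ℝ)) N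
          (L₂ (barlowPos 1 (Real.sqrt (2 / 3)) σ₂ (mi i) (ai i) (bi i)) + s₂, [⟨L₂, r, 0⟩])).1 ∈
        X.filter (fun y => (X.filter fun q => dist y q = 1).card ≠ 12 ∧ -R₀ - 2 ≤ y 2 ∧ y 2 ≤ h + R₀ + 2) ∧
      (walkRun X (-EuclideanSpace.single (2 : Fin 3) (1 : ℝ)) N
          (L₂ (barlowPos 1 (Real.sqrt (2 / 3)) σ₂ (mi i) (ai i) (bi i)) + s₂, [⟨L₂, r, 0⟩])).1 ∈
        reachSet L₂ (L₂ ((haggLabel σ₂ 0 : ℝ) • barlowOffset 1) + s₂)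
          (insert (twinFrame L₂ (L₂ (EuclideanSpace.single (2 : Fin 3) (1 : ℝ))))
            (chainFrames (-EuclideanSpace.single (2 : Fin 3) (1 : ℝ)) L₂ r))) ∧
    (∀ i ∈ T, ∀ j ∈ T,
      walkRun X (-EuclideanSpace.single (2 : Fin 3) (1 : ℝ)) N
          (L₂ (barlowPos 1 (Real.sqrt (2 / 3)) σ₂ (mi i) (ai i) (bi i)) + s₂, [⟨L₂, r, 0⟩]) =
        walkRun X (-EuclideanSpace.single (2 : Fin 3) (1 : ℝ)) N
          (L₂ (barlowPos 1 (Real.sqrt (2 / 3)) σ₂ (mi j) (ai j) (bi j)) + s₂, [⟨L₂, r, 0⟩]) → i = j) := by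
  set zt : EuclideanSpace ℝ (Fin 3) := -EuclideanSpace.single (2 : Fin 3) (1 : ℝ) with hzt
  have hztn : ‖zt‖ = 1 := by rw [hzt, norm_neg, PiLp.norm_single, norm_one]
  have hzti : ∀ d : EuclideanSpace ℝ (Fin 3), ⟪d, zt⟫_ℝ = -d 2 := fun d => by
    rw [hzt, inner_neg_right, EuclideanSpace.inner_single_right]; simp
  set bp : ℤ → ℤ → ℤ → EuclideanSpace ℝ (Fin 3) := fun m a b => barlowPos 1 (Real.sqrt (2 / 3)) σ₂ m a b with hbp
  have hLr : ‖L₂ r‖ = 1 := by rw [LinearIsometryEquiv.norm_map, norm_eq_one_of_mem_fccSlots hr]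
  have hLr2 : -1 ≤ (L₂ r) 2 := by
    have h1 := abs_apply_sub_le_dist (L₂ r) 0 2
    rw [dist_zero_right, hLr] at h1
    have : (0 : EuclideanSpace ℝ (Fin 3)) 2 = 0 := rfl
    rw [this, sub_zero] at h1
    exact (abs_le.1 h1).1
  -- the predecessor of each start: `q i + r = p i`
  have hqp : ∀ i, bp (mi i) (ai i - α) (bi i - β) + r = bp (mi i) (ai i) (bi i) := by
    intro i
    show barlowPos 1 (Real.sqrt (2 / 3)) σ₂ (mi i) (ai i - α) (bi i - β) + r = barlowPos 1 (Real.sqrt (2 / 3)) σ₂ (mi i) (ai i) (bi i)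
    rw [hrαβ, barlowPos_add_inplane, sub_add_cancel, sub_add_cancel]
  have hqeq : ∀ i, bp (mi i) (ai i) (bi i) - r = bp (mi i) (ai i - α) (bi i - β) := fun i => by
    rw [← hqp i, add_sub_cancel_right]
  have hq2 : ∀ i, (L₂ (bp (mi i) (ai i - α) (bi i - β)) + s₂) 2 = (L₂ (bp (mi i) (ai i) (bi i)) + s₂) 2 - (L₂ r) 2 := by
    intro i; rw [← hqp i, map_add]; simp; ring
  -- the predecessor is deep, hence full
  have hfullpred : ∀ i ∈ T, L₂ (bp (mi i) (ai i - α) (bi i - β)) + s₂ ∈ X ∧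
      ∀ w ∈ fccSlots, L₂ (bp (mi i) (ai i - α) (bi i - β)) + s₂ + L₂ w ∈ X := by
    intro i hi
    have hpredi := hpred i hi
    rw [hzti, hq2 i] at hpredi
    have hlowi := hlow i hi
    rw [hzti] at hlowi
    -- true heights: the predecessor lies in `[−H, −H + 1]`-ish: `h + R₀ + 1 ≤ · ≤ h + 2R₀ − 1`
    have hpl : h + R₀ + 1 ≤ (L₂ (bp (mi i) (ai i - α) (bi i - β)) + s₂) 2 := by rw [hq2 i]; linarith
    have hphh : (L₂ (bp (mi i) (ai i - α) (bi i - β)) + s₂) 2 ≤ h + 2 * R₀ - 1 := by rw [hq2 i]; linarith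
    have hplat : Real.sqrt ((L₂ (bp (mi i) (ai i - α) (bi i - β)) + s₂) 0 ^ 2 +
        (L₂ (bp (mi i) (ai i - α) (bi i - β)) + s₂) 1 ^ 2) ≤ ρin + 1 := by
      have h1 := sqrt_lateral_add_le (L₂ (bp (mi i) (ai i) (bi i)) + s₂) (-(L₂ r))
      have e : L₂ (bp (mi i) (ai i) (bi i)) + s₂ + -L₂ r = L₂ (bp (mi i) (ai i - α) (bi i - β)) + s₂ := by
        rw [← hqp i, map_add]; abel
      rw [e, norm_neg, hLr] at h1
      have := hlat i hi; linarith
    refine barlow_cc_full σ₂ L₂ s₂ (mi i) (ai i - α) (bi i - β) (hcc i hi).1 (hcc i hi).2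
      (barlowWindow_complete_gen L₂ s₂ (h + R₀) (h + 2 * R₀) ρ hρ P₂ hP₂X hP₂ (mi i) (ai i - α) (bi i - β)
        (by linarith) (by linarith) ?_)
    have h0 : 0 ≤ (L₂ (bp (mi i) (ai i - α) (bi i - β)) + s₂) 0 ^ 2 + (L₂ (bp (mi i) (ai i - α) (bi i - β)) + s₂) 1 ^ 2 := by
      positivity
    have hrr : Real.sqrt ((L₂ (bp (mi i) (ai i - α) (bi i - β)) + s₂) 0 ^ 2 +
        (L₂ (bp (mi i) (ai i - α) (bi i - β)) + s₂) 1 ^ 2) ≤ ρ - 1 := by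
      have : 0 ≤ 8 / 3 * (h + 4 * R₀) := by positivity
      linarith
    have h7 := pow_le_pow_left₀ (Real.sqrt_nonneg _) hrr 2
    rwa [Real.sq_sqrt h0] at h7
  -- validity of every start
  have hvalid : ∀ i ∈ T, WalkInv X zt (L₂ (bp (mi i) (ai i) (bi i)) + s₂, [⟨L₂, r, 0⟩]) ∧
      StackWF zt ([⟨L₂, r, 0⟩] : List WalkEntry) ∧ ([⟨L₂, r, 0⟩] : List WalkEntry).getLast? = some ⟨L₂, r, 0⟩ ∧
      WalkCertified12 X (L₂ (bp (mi i) (ai i) (bi i)) + s₂) ⟨L₂, r, 0⟩ := fun i hi =>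
    rowStart_valid L₂ s₂ hr hsteep (hqp i) (hfullpred i hi).1 (hfullpred i hi).2
  -- injectivity
  have hinj := rowFamily_walkRun_injOn hX hsE hcert hztn L₂ s₂ hr hsteep T (fun i => bp (mi i) (ai i) (bi i))
    (fun i hi => by simp only [hqeq i]; exact hfullpred i hi) H hlow
    (fun i hi => by simp only [hqeq i]; exact hpred i hi) hinjT N
  refine ⟨fun i hi => ?_, hinj⟩
  obtain ⟨hI, hW, hlast, hC⟩ := hvalid i hi
  have hstartX : L₂ (bp (mi i) (ai i) (bi i)) + s₂ ∈ X := hI.1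
  have hlowi := hlow i hi
  rw [hzti] at hlowi
  have hfuel : 8 * (2 * R₀ - ⟪L₂ (bp (mi i) (ai i) (bi i)) + s₂, zt⟫_ℝ) < 3 * N := by
    rw [hzti]; linarith
  -- reach set of the start, frames of the family
  have hreach : L₂ (bp (mi i) (ai i) (bi i)) + s₂ ∈
      reachSet L₂ (L₂ ((haggLabel σ₂ 0 : ℝ) • barlowOffset 1) + s₂) (insert (twinFrame L₂ (L₂ (-zt))) (chainFrames zt L₂ r)) := by
    have : -zt = EuclideanSpace.single (2 : Fin 3) (1 : ℝ) := by rw [hzt, neg_neg]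
    rw [this]
    exact barlow_mem_reachSet_row zt L₂ s₂ r hσ₂ (mi i) (ai i) (bi i)
  have hzz : -zt = EuclideanSpace.single (2 : Fin 3) (1 : ℝ) := by rw [hzt, neg_neg]
  rw [hzz] at hreach
  have hM₂ : ∀ stk : List WalkEntry, StackSound zt stk → StackWF zt stk → stk.getLast? = some ⟨L₂, r, 0⟩ →
      ∀ e ∈ stk, e.frame ∈ insert (twinFrame L₂ (L₂ (EuclideanSpace.single (2 : Fin 3) (1 : ℝ)))) (chainFrames zt L₂ r) :=
    mem_rowFrames_of_stack
  have hlat' : Real.sqrt ((L₂ (bp (mi i) (ai i) (bi i)) + s₂) 0 ^ 2 + (L₂ (bp (mi i) (ai i) (bi i)) + s₂) 1 ^ 2) +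
      8 / 3 * (h + 4 * R₀) ≤ ρ - 1 := by have := hlat i hi; linarith
  -- the end: not low (reach set off the bottom stacking), lateral radius, `≤ 11` contacts
  obtain ⟨hyX, hydeg, hylat, hylow⟩ := walkEnd_not_low_barlow hX hsE hcert hσ₁ L₁ L₂ s₀ (L₂ ((haggLabel σ₂ 0 : ℝ) • barlowOffset 1) + s₂)
    R₀ h ρ hρ P₁ hP₁X hcell hP₁ _ hM₂ hoff (s := (L₂ (bp (mi i) (ai i) (bi i)) + s₂, [⟨L₂, r, 0⟩])) hI hW hlast hreach hlat' hfuel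
  -- NOT HIGH by sealing: above `h + R₀ + 2` the end would be a plate site with twelve neighbours
  have hmono := walkRun_height_ge hX hsE hcert hztn N (L₂ (bp (mi i) (ai i) (bi i)) + s₂, [⟨L₂, r, 0⟩]) hI
  simp only at hmono
  rw [hzti, hzti] at hmono
  set y := (walkRun X zt N (L₂ (bp (mi i) (ai i) (bi i)) + s₂, [⟨L₂, r, 0⟩])).1 with hy
  have hhigh' : y 2 ≤ h + R₀ + 2 := by
    by_contra hlt
    push Not at hlt
    -- `y` is a plate ball
    have hyP : y ∈ P₂ := by
      by_contra hyP
      exact stacking_sealing_above hσ₂ L₂ s₂ (h + R₀) (h + 2 * R₀) ρ hρ X P₂ hX hP₂X hP₂ y hyX hyP (by linarith)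
        (hcell y hyX).2.1 hylat
    obtain ⟨⟨y', hy'S, hyy'⟩, -, -, -⟩ := (hP₂ y).1 hyP
    obtain ⟨m, a, b, rfl⟩ := hy'S
    have hyy : L₂ (barlowPos 1 (Real.sqrt (2 / 3)) σ₂ m a b) + s₂ = y := hyy'
    -- all its touching sites are occupied
    have hcomp := barlowWindow_complete_gen L₂ s₂ (h + R₀) (h + 2 * R₀) ρ hρ P₂ hP₂X hP₂ m a b (by rw [hyy]; linarith)
      (by rw [hyy]; linarith) (by rw [hyy]; exact hylat)
    have h12 := twelve_le_card_contacts_of_complete_site hσ₂ L₂ s₂ m a b hcomp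
    rw [hyy] at h12
    omega
  have hPAY : y ∈ X.filter (fun y => (X.filter fun q => dist y q = 1).card ≠ 12 ∧ -R₀ - 2 ≤ y 2 ∧ y 2 ≤ h + R₀ + 2) := by
    rw [Finset.mem_filter]
    exact ⟨hyX, by omega, by linarith, hhigh'⟩
  have hendreach := walkRun_fst_mem_reachSet hX hsE hcert hztn hM₂ N _ hI hW hlast hreach
  exact ⟨hI, hW, hlast, ⟨⟨L₂, r, 0⟩, [], rfl, hC⟩, hfuel, hPAY, hendreach⟩

end Cell

end Summit.Ventures.Crystal3D.Theorems

end
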